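import Summits.HubbardSuperconductivity.HubbardSuperconductivity.Theorems.AnisotropyChordTransferFibre3FinXDCheck

/-!
# Route `AnisotropyChord` / H0 rotor rung: FIN per-`L` row-D (KT-2a″) SUB-CELL facts, `L = 10` (12–17)

Row-D facts `xdCellAny0 10 (49/50) la lb aD = true` on quarter sub-cells of the combined cells whose side condition needs `aD ≈ .04` (mechhunt STATUS p3 g7 REPORT 3).
Prover seat `hubbard-h0-rotor-p3` g7; helper for piece A = stmt-HubbardSuperconductivity-23918 of rung 19089 (`--supports`, helper class).
WHAT THIS IS NOT: nothing here proves superconductivity in the Hubbard model (rotor TARGET as worded stays FALSE, g15 verdict); kernel facts /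
assembly for ONE conditional reduction at one `L`.  No sorry.
-/

set_option linter.dupNamespace false
set_option autoImplicit false

namespace Summit.HubbardSuperconductivity.HubbardSuperconductivity.Theorems.AnisotropyChord.Transfer.Fibre3

namespace FinXD

/-- row-D sub-cell `[14941644172187919, 15035029448264093]` of `L = 10`. [folklore] -/
theorem xd10s_132_0 : xdCellAny0 10 (49/50 : ℚ) 14941644172187919 15035029448264093 (1/25 : ℚ) = true := by decide +kernel

/-- row-D sub-cell `[15035029448264093, 15128414724340268]` of `L = 10`. [folklore] -/
theorem xd10s_132_1 : xdCellAny0 10 (49/50 : ℚ) 15035029448264093 15128414724340268 (1/25 : ℚ) = true := by decide +kernel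

/-- row-D sub-cell `[15128414724340268, 15221800000416442]` of `L = 10`. [folklore] -/
theorem xd10s_132_2 : xdCellAny0 10 (49/50 : ℚ) 15128414724340268 15221800000416442 (1/25 : ℚ) = true := by decide +kernel

/-- row-D sub-cell `[15221800000416442, 15315185276492617]` of `L = 10`. [folklore] -/
theorem xd10s_132_3 : xdCellAny0 10 (49/50 : ℚ) 15221800000416442 15315185276492617 (1/25 : ℚ) = true := by decide +kernel

/-- row-D sub-cell `[15315185276492617, 15410905184470695]` of `L = 10`. [folklore] -/
theorem xd10s_133_0 : xdCellAny0 10 (49/50 : ℚ) 15315185276492617 15410905184470695 (1/25 : ℚ) = true := by decide +kernel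

/-- row-D sub-cell `[15410905184470695, 15506625092448774]` of `L = 10`. [folklore] -/
theorem xd10s_133_1 : xdCellAny0 10 (49/50 : ℚ) 15410905184470695 15506625092448774 (1/25 : ℚ) = true := by decide +kernel

end FinXD

end Summit.HubbardSuperconductivity.HubbardSuperconductivity.Theorems.AnisotropyChord.Transfer.Fibre3
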